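import Summits.FinalStateConjecture.FinalStateConjecture.Theorems.ExactKerrEndsCensorshipAlongKerrEndsDefs
import Literature.Geometry.Lorentzian.InitialDataPatch
import Literature.Geometry.Lorentzian.AFEndPatch
import Literature.Geometry.Lorentzian.AdmissibleDataLocality
import Literature.Geometry.Lorentzian.InitialDataLocality
import Literature.Geometry.Lorentzian.TameFamilyOffCompact
import Literature.Geometry.Lorentzian.ExactKerrEnd
import Literature.Geometry.Lorentzian.LeviCivitaProofs
import HarnessLib

/-!
# Crux `CensorshipAlongKerrEnds` (stmt-FinalStateConjecture-18521), line `Sketch` v4 (compact-support architecture):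
# stub `stub_patchAlongCompactFamily` — THE PATCH

Let `G : ℝ¹ → InitialDataSet (𝓡 3) X` be a tame family of admissible data on the end `e` (masses `Mf c`) which is a
COMPACTLY SUPPORTED modification of its base `G 0` (`G c = G 0` off a compact `K₀`, all `c`), and let `Ĝ R`
(`R > R⋆₁ > e.R`) be a radius-indexed RECEDING RE-ENDING of the base: admissible Kerr-ended data, jointly smooth in
`(R, x)`, equal to `G 0` off `e.far R`, DR-flat with masses `m₁ R → Mf 0`, `e.wDist (Ĝ R) (G 0) → 0`. Choose
`Rₐ ≥ R⋆₁` with `K₀ ∩ e.far Rₐ = ∅` (`AFEnd.exists_forall_far_disjoint`), `R_b = Rₐ + 1`, and `R⋆ ≥ R_b` beyond which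
`e.wDist (Ĝ R) (G 0) < 1`. The glued family is the PATCH (`InitialDataSet.patch`, `Literature/…/InitialDataPatch.lean`)

  `H c R := G c` off `e.far Rₐ`,  `:= Ĝ (max R R⋆)` on `e.far Rₐ`

(open set `W = e.far Rₐ`, closed set `C = e.closedFar R_b ⊆ W`; on the collar `W ∖ C` both prescriptions equal `G 0`).
Then (`stub_patchAlongCompactFamily`, the registered text verbatim): `GluedStructure e G 1 R⋆ m H` (masses
`m c R = m₁ (max R R⋆)` continuous; sections jointly smooth in `((c, R), x)` by LOCALITY — near a point over `W` they are
those of `(R, x) ↦ Ĝ R`, near a point over `Cᶜ` those of `(c, x) ↦ G c`; `H c R = G c` off `e.far R`; DR-flat by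
`IsStronglyAsymptoticallyFlatDR.congr_of_eqOn_far`), members admissible (`mem_admissibleVacuumData_of_agree_off_compact`:
vacuum is local, `isVacuumAt_congr`; `H c R = Ĝ _` off the compact `(e.far Rₐ)ᶜ`, `IsSoleEnd.isCompact_compl_far`) and
Kerr-ended (`HasExactKerrEnd.of_eq_off_compact`), far field on `e.far R⋆` independent of `c`, and
`e.wDist (H c R) (G c) = e.wDist (Ĝ (max R R⋆)) (G 0)` EXACTLY (the two coefficient differences agree on `{‖y‖ > e.R}`,
`wDist_eq_of_coeff_sub_eq`) — whence pointwise convergence, `JointConvergence` (continuity of `Mf` at `0`) and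
`UniformBound` (`B = 1`).

References: Corvino, CMP 214 (2000), §4 (data equal to the original inside and to the model outside a large sphere);
Corvino–Schoen, JDG 73 (2006), Thm. 4; Bartnik, CPAM 39 (1986), §1 (the sets `E_R`); Dafermos–Rodnianski,
arXiv:0811.0354, App. B.2.3 (the weighted distance).
-/

-- the doubled `FinalStateConjecture.FinalStateConjecture` path component trips dupNamespace
set_option linter.dupNamespace false

noncomputable section

open Set Function Filter Bundle
open scoped Manifold ContDiff Topology ENNReal

namespace Summit.FinalStateConjecture.FinalStateConjecture.Theorems.ExactKerrEnds.CensorshipAlongKerrEnds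

open Literature.Geometry.Lorentzian
open Summit.FinalStateConjecture.FinalStateConjecture.Theorems.SwallowTheDatum.ParametricKerrBurial
  (SmoothSectionsOn AgreeAt)

section Lemmas

variable {X : Type} [TopologicalSpace X] [ChartedSpace E3 X] [IsManifold (𝓡 3) ∞ X]

/-- **The weighted distance only sees the coefficient differences**: if the differences of the chart components of
`(D₁, D₁')` and of `(D₂, D₂')` agree at every point of the open exterior region `{‖y‖ > e.R}`, then
`e.wDist D₁ D₁' = e.wDist D₂ D₂'` (`iteratedFDeriv` is local). [cite: DafermosRodnianski2013, App. B.2.3] -/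
theorem wDist_eq_of_coeff_sub_eq (e : AFEnd X) {D₁ D₁' D₂ D₂' : InitialDataSet (𝓡 3) X}
    (hh : ∀ y : E3, e.R < ‖y‖ → AFEnd.hCoeff e D₁ y - AFEnd.hCoeff e D₁' y = AFEnd.hCoeff e D₂ y - AFEnd.hCoeff e D₂' y)
    (hk : ∀ y : E3, e.R < ‖y‖ → AFEnd.kCoeff e D₁ y - AFEnd.kCoeff e D₁' y = AFEnd.kCoeff e D₂ y - AFEnd.kCoeff e D₂' y) :
    e.wDist D₁ D₁' = e.wDist D₂ D₂' := by
  unfold AFEnd.wDist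
  congr 1
  · refine iSup_congr fun m ↦ iSup_congr fun _ ↦ iSup_congr fun x ↦ iSup_congr fun hx ↦ ?_
    have hev : (fun y ↦ AFEnd.hCoeff e D₁ y - AFEnd.hCoeff e D₁' y) =ᶠ[𝓝 x]
        fun y ↦ AFEnd.hCoeff e D₂ y - AFEnd.hCoeff e D₂' y := by
      filter_upwards [(isOpen_lt continuous_const continuous_norm).mem_nhds hx] with y hy
      exact hh y hy
    rw [(hev.iteratedFDeriv ℝ m).eq_of_nhds]
  · refine iSup_congr fun m ↦ iSup_congr fun _ ↦ iSup_congr fun x ↦ iSup_congr fun hx ↦ ?_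
    have hev : (fun y ↦ AFEnd.kCoeff e D₁ y - AFEnd.kCoeff e D₁' y) =ᶠ[𝓝 x]
        fun y ↦ AFEnd.kCoeff e D₂ y - AFEnd.kCoeff e D₂' y := by
      filter_upwards [(isOpen_lt continuous_const continuous_norm).mem_nhds hx] with y hy
      exact hk y hy
    rw [(hev.iteratedFDeriv ℝ m).eq_of_nhds]

/-- The difference of the metric chart components at `y` (`‖y‖ > e.R`) is determined by the difference of the metrics
at the chart point `e.dataChartExt y`. [cite: Bartnik1986, (1.3)] -/
theorem hCoeff_sub_eq_of_inner_sub_eq (e : AFEnd X) {D₁ D₁' D₂ D₂' : InitialDataSet (𝓡 3) X} {y : E3}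
    (hy : e.R < ‖y‖)
    (h : ∀ v w : TangentSpace (𝓡 3) (e.dataChartExt y),
      D₁.h.inner (e.dataChartExt y) v w - D₁'.h.inner (e.dataChartExt y) v w =
        D₂.h.inner (e.dataChartExt y) v w - D₂'.h.inner (e.dataChartExt y) v w) :
    AFEnd.hCoeff e D₁ y - AFEnd.hCoeff e D₁' y = AFEnd.hCoeff e D₂ y - AFEnd.hCoeff e D₂' y := by
  ext v w
  simp only [_root_.sub_apply, e.hCoeff_apply_eq_dataChartExt _ hy]
  exact h _ _

/-- The same for the components of `k`. [cite: ChristodoulouKlainerman1993, (1.0.9)] -/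
theorem kCoeff_sub_eq_of_k_sub_eq (e : AFEnd X) {D₁ D₁' D₂ D₂' : InitialDataSet (𝓡 3) X} {y : E3}
    (hy : e.R < ‖y‖)
    (h : ∀ v w : TangentSpace (𝓡 3) (e.dataChartExt y),
      D₁.k (e.dataChartExt y) v w - D₁'.k (e.dataChartExt y) v w =
        D₂.k (e.dataChartExt y) v w - D₂'.k (e.dataChartExt y) v w) :
    AFEnd.kCoeff e D₁ y - AFEnd.kCoeff e D₁' y = AFEnd.kCoeff e D₂ y - AFEnd.kCoeff e D₂' y := by
  ext v w
  simp only [_root_.sub_apply, e.kCoeff_apply_eq_dataChartExt _ hy]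
  exact h _ _

/-- **A patch of vacuum data by vacuum data is vacuum** (the constraint functions at `x` only see the germ of the data
at `x`: near a point of `W` the patch is `D₁`, near a point off `C` it is `D`). [cite: Corvino2000, §4] -/
theorem isVacuumConstraintSolution_patch_of_vacuum {D D₁ : InitialDataSet (𝓡 3) X} {W C : Set X}
    (P : D.PatchData W C D₁.h.inner D₁.k) [(D.patch P).metric.HasLeviCivita]
    (hD : ∀ [D.metric.HasLeviCivita], D.IsVacuumConstraintSolution)
    (hD₁ : ∀ [D₁.metric.HasLeviCivita], D₁.IsVacuumConstraintSolution) :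
    (D.patch P).IsVacuumConstraintSolution := by
  haveI : D.metric.HasLeviCivita := D.metric.hasLeviCivita
  haveI : D₁.metric.HasLeviCivita := D₁.metric.hasLeviCivita
  intro x
  by_cases hx : x ∈ W
  · have hev := InitialDataSet.patch_eventuallyEq_of_mem P hx
    exact (InitialDataSet.isVacuumAt_congr (hev.mono fun y hy ↦ hy.1) (hev.mono fun y hy ↦ hy.2)).2 (hD₁ x)
  · have hxC : x ∉ C := fun h ↦ hx (P.subset h)
    have hev := InitialDataSet.patch_eventuallyEq_of_not_mem P hxC
    exact (InitialDataSet.isVacuumAt_congr (hev.mono fun y hy ↦ hy.1) (hev.mono fun y hy ↦ hy.2)).2 (hD x)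

/-- **Joint smoothness of a two-parameter patch of sections, by locality.** Let `W` be open, `C ⊆ W` closed, let
`b c` (`c ∈ ℝ¹`) be a family of sections jointly smooth on `ℝ¹ × X` and `a R` (`R > R⋆₁`) a family jointly smooth on
`{R⋆₁ < R} × X`, and let the sections `s c R` equal `a (max R R⋆)` on `W` and `b c` off `C` (`R⋆ > R⋆₁`). Then
`((c, R), x) ↦ s c R x` is jointly smooth on `{‖c‖ < 1, R⋆ < R} × X`: near a point over `W` it is
`a ∘ (q ↦ (q.1.2, q.2))`, near a point over `Cᶜ` it is `b ∘ (q ↦ (q.1.1, q.2))`. [cite: Corvino2000, §4] -/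
theorem contMDiffOn_twoParam_sections {W C : Set X} (hWo : IsOpen W) (hCc : IsClosed C) (hCW : C ⊆ W)
    {Rs₁ Rstar : ℝ} (hRs : Rs₁ < Rstar)
    {a : ℝ → AFEnd.BilinField X} {b : EuclideanSpace ℝ (Fin 1) → AFEnd.BilinField X}
    {s : EuclideanSpace ℝ (Fin 1) → ℝ → AFEnd.BilinField X}
    (ha : ContMDiffOn (𝓘(ℝ, ℝ).prod (𝓡 3)) ((𝓡 3).prod 𝓘(ℝ, E3 →L[ℝ] E3 →L[ℝ] ℝ)) ∞
      (fun p : ℝ × X ↦ TotalSpace.mk' (E3 →L[ℝ] E3 →L[ℝ] ℝ)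
        (E := fun x : X ↦ TangentSpace (𝓡 3) x →L[ℝ] TangentSpace (𝓡 3) x →L[ℝ] ℝ) p.2 (a p.1 p.2))
      {p : ℝ × X | Rs₁ < p.1})
    (hb : ContMDiff (𝓘(ℝ, EuclideanSpace ℝ (Fin 1)).prod (𝓡 3)) ((𝓡 3).prod 𝓘(ℝ, E3 →L[ℝ] E3 →L[ℝ] ℝ)) ∞
      (fun p : EuclideanSpace ℝ (Fin 1) × X ↦ TotalSpace.mk' (E3 →L[ℝ] E3 →L[ℝ] ℝ)
        (E := fun x : X ↦ TangentSpace (𝓡 3) x →L[ℝ] TangentSpace (𝓡 3) x →L[ℝ] ℝ) p.2 (b p.1 p.2)))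
    (hsW : ∀ (c : EuclideanSpace ℝ (Fin 1)) (R : ℝ), ∀ x ∈ W, s c R x = a (max R Rstar) x)
    (hsC : ∀ (c : EuclideanSpace ℝ (Fin 1)) (R : ℝ), ∀ x ∉ C, s c R x = b c x) :
    ContMDiffOn ((𝓘(ℝ, EuclideanSpace ℝ (Fin 1)).prod 𝓘(ℝ, ℝ)).prod (𝓡 3)) ((𝓡 3).prod 𝓘(ℝ, E3 →L[ℝ] E3 →L[ℝ] ℝ)) ∞
      (fun q : (EuclideanSpace ℝ (Fin 1) × ℝ) × X ↦ TotalSpace.mk' (E3 →L[ℝ] E3 →L[ℝ] ℝ)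
        (E := fun x : X ↦ TangentSpace (𝓡 3) x →L[ℝ] TangentSpace (𝓡 3) x →L[ℝ] ℝ) q.2 (s q.1.1 q.1.2 q.2))
      (gluedDom X 1 Rstar) := by
  have hπR : ContMDiff ((𝓘(ℝ, EuclideanSpace ℝ (Fin 1)).prod 𝓘(ℝ, ℝ)).prod (𝓡 3)) (𝓘(ℝ, ℝ).prod (𝓡 3)) ∞
      (fun q : (EuclideanSpace ℝ (Fin 1) × ℝ) × X ↦ (q.1.2, q.2)) :=
    (contMDiff_snd.comp contMDiff_fst).prodMk contMDiff_snd
  have hπc : ContMDiff ((𝓘(ℝ, EuclideanSpace ℝ (Fin 1)).prod 𝓘(ℝ, ℝ)).prod (𝓡 3))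
      (𝓘(ℝ, EuclideanSpace ℝ (Fin 1)).prod (𝓡 3)) ∞
      (fun q : (EuclideanSpace ℝ (Fin 1) × ℝ) × X ↦ (q.1.1, q.2)) :=
    (contMDiff_fst.comp contMDiff_fst).prodMk contMDiff_snd
  have hRcont : Continuous fun q : (EuclideanSpace ℝ (Fin 1) × ℝ) × X ↦ q.1.2 :=
    continuous_snd.comp continuous_fst
  intro q₀ hq₀
  by_cases hq₀W : q₀.2 ∈ W
  · -- near a point over `W`: the sections are those of `a`, read through `q ↦ (q.1.2, q.2)`
    have hnhds : {p : ℝ × X | Rs₁ < p.1} ∈ 𝓝 (q₀.1.2, q₀.2) :=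
      (isOpen_lt continuous_const continuous_fst).mem_nhds (hRs.trans hq₀.2)
    have hev : (fun q : (EuclideanSpace ℝ (Fin 1) × ℝ) × X ↦ TotalSpace.mk' (E3 →L[ℝ] E3 →L[ℝ] ℝ)
          (E := fun x : X ↦ TangentSpace (𝓡 3) x →L[ℝ] TangentSpace (𝓡 3) x →L[ℝ] ℝ) q.2 (s q.1.1 q.1.2 q.2)) =ᶠ[𝓝 q₀]
        ((fun p : ℝ × X ↦ TotalSpace.mk' (E3 →L[ℝ] E3 →L[ℝ] ℝ)
          (E := fun x : X ↦ TangentSpace (𝓡 3) x →L[ℝ] TangentSpace (𝓡 3) x →L[ℝ] ℝ) p.2 (a p.1 p.2)) ∘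
          fun q ↦ (q.1.2, q.2)) := by
      filter_upwards [continuousAt_snd.preimage_mem_nhds (hWo.mem_nhds hq₀W),
        hRcont.continuousAt.preimage_mem_nhds (isOpen_Ioi.mem_nhds hq₀.2)] with q hq1 hq2
      rw [comp_apply, hsW q.1.1 q.1.2 q.2 hq1, max_eq_left (le_of_lt hq2)]
    exact (((ha.contMDiffAt hnhds).comp q₀ (hπR q₀)).congr_of_eventuallyEq hev).contMDiffWithinAt
  · -- near a point over `Cᶜ`: the sections are those of `b`, read through `q ↦ (q.1.1, q.2)`
    have hq₀C : q₀.2 ∉ C := fun h ↦ hq₀W (hCW h)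
    have hev : (fun q : (EuclideanSpace ℝ (Fin 1) × ℝ) × X ↦ TotalSpace.mk' (E3 →L[ℝ] E3 →L[ℝ] ℝ)
          (E := fun x : X ↦ TangentSpace (𝓡 3) x →L[ℝ] TangentSpace (𝓡 3) x →L[ℝ] ℝ) q.2 (s q.1.1 q.1.2 q.2)) =ᶠ[𝓝 q₀]
        ((fun p : EuclideanSpace ℝ (Fin 1) × X ↦ TotalSpace.mk' (E3 →L[ℝ] E3 →L[ℝ] ℝ)
          (E := fun x : X ↦ TangentSpace (𝓡 3) x →L[ℝ] TangentSpace (𝓡 3) x →L[ℝ] ℝ) p.2 (b p.1 p.2)) ∘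
          fun q ↦ (q.1.1, q.2)) := by
      filter_upwards [continuousAt_snd.preimage_mem_nhds (hCc.isOpen_compl.mem_nhds hq₀C)] with q hq
      rw [comp_apply, hsC q.1.1 q.1.2 q.2 hq]
    exact (((hb (q₀.1.1, q₀.2)).comp q₀ (hπc q₀)).congr_of_eventuallyEq hev).contMDiffWithinAt

end Lemmas

/-- **Stub `stub_patchAlongCompactFamily` — THE PATCH** (registered text verbatim): from a compactly supported tame
family `G` of admissible data on `e` and a radius-indexed receding re-ending `Ĝ` of its base `G 0`, the glued
two-parameter family `H c R = G c ⊔ Ĝ (max R R⋆)` with `GluedStructure`, admissible Kerr-ended members,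
`c`-independent far field, pointwise and joint weighted convergence and the uniform bound. [cite: Corvino2000, §4]
[cite: CorvinoSchoen2006, Thm. 4] -/
theorem stub_patchAlongCompactFamily : ∀ (X : Type) [TopologicalSpace X] [ChartedSpace Literature.Geometry.Lorentzian.E3 X] [IsManifold (𝓡 3) ((⊤ : ℕ∞) : WithTop ℕ∞) X] [T2Space X] [SecondCountableTopology X] [ConnectedSpace X], ∀ (e : Literature.Geometry.Lorentzian.AFEnd X) (G : EuclideanSpace ℝ (Fin 1) → Literature.Geometry.Lorentzian.InitialDataSet (𝓡 3) X) (Mf : EuclideanSpace ℝ (Fin 1) → ℝ), Literature.Geometry.Lorentzian.InitialDataSet.IsTameDataFamily e 1 G → (∀ c, G c ∈ Literature.Geometry.Lorentzian.admissibleVacuumData X) → Continuous Mf → (∀ c, e.IsStronglyAsymptoticallyFlatDR (G c) (Mf c)) → (∃ K : Set X, IsCompact K ∧ ∀ (c : EuclideanSpace ℝ (Fin 1)) (x : X), x ∉ K → Summit.FinalStateConjecture.FinalStateConjecture.Theorems.SwallowTheDatum.ParametricKerrBurial.AgreeAt (G c) (G 0) x) → (∃ (Rstar : ℝ) (m : ℝ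 → ℝ) (Gh : ℝ → Literature.Geometry.Lorentzian.InitialDataSet (𝓡 3) X), e.R < Rstar ∧ ContinuousOn m (Set.Ioi Rstar) ∧ Filter.Tendsto m Filter.atTop (nhds (Mf 0)) ∧ Summit.FinalStateConjecture.FinalStateConjecture.Theorems.SwallowTheDatum.ParametricKerrBurial.SmoothSectionsOn 𝓘(ℝ, ℝ) Gh {p : ℝ × X | Rstar < p.1} ∧ (∀ R : ℝ, Rstar < R → Gh R ∈ Literature.Geometry.Lorentzian.admissibleVacuumData X ∧ (∀ x ∉ e.far R, Summit.FinalStateConjecture.FinalStateConjecture.Theorems.SwallowTheDatum.ParametricKerrBurial.AgreeAt (Gh R) (G 0) x) ∧ e.IsStronglyAsymptoticallyFlatDR (Gh R) (m R) ∧ (Gh R).HasExactKerrEnd) ∧ Filter.Tendsto (fun R ↦ e.wDist (Gh R) (G 0)) Filter.atTop (nhds 0)) → ∃ (ε Rstar : ℝ) (m : EuclideanSpace ℝ (Fin 1) → ℝ → ℝ) (H : EuclideanSpace ℝ (Fin 1) → ℝ → Literature.Geometry.Lorentzian.InitialDataSet (𝓡 3) X), 0 < ε ∧ e.R < Rstar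 ∧ Summit.FinalStateConjecture.FinalStateConjecture.Theorems.ExactKerrEnds.GluedStructure e G ε Rstar m H ∧ (∀ (c : EuclideanSpace ℝ (Fin 1)) (R : ℝ), ‖c‖ < ε → Rstar < R → H c R ∈ Literature.Geometry.Lorentzian.admissibleVacuumData X ∧ (H c R).HasExactKerrEnd) ∧ (∀ (c c' : EuclideanSpace ℝ (Fin 1)) (R : ℝ), ∀ x ∈ e.far Rstar, Summit.FinalStateConjecture.FinalStateConjecture.Theorems.SwallowTheDatum.ParametricKerrBurial.AgreeAt (H c R) (H c' R) x) ∧ (∀ c : EuclideanSpace ℝ (Fin 1), ‖c‖ < ε → Filter.Tendsto (fun R ↦ e.wDist (H c R) (G c)) Filter.atTop (nhds 0)) ∧ Summit.FinalStateConjecture.FinalStateConjecture.Theorems.ExactKerrEnds.JointConvergence e G Mf ε Rstar m H ∧ Summit.FinalStateConjecture.FinalStateConjecture.Theorems.ExactKerrEnds.UniformBound e G ε Rstar H := by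
  intro X _ _ _ _ _ _ e G Mf hGt hGadm hMf hDR ⟨K₀, hK₀, hK₀G⟩ ⟨Rs₁, m₁, Gh, hRs₁, hm₁, hm₁M, hGh, hmem, hw⟩
  have hsole : e.IsSoleEnd := hGt.2.1
  have hGsm : InitialDataSet.IsSmoothDataFamily 1 G := hGt.1
  /- radii: `Ra` (the patch region `W = e.far Ra` avoids `K₀`), `Rb = Ra + 1` (the closed set `C = e.closedFar Rb`),
  `Rstar ≥ Rb` (beyond which the re-ending is weighted-close to the base) -/
  obtain ⟨R₀, hR₀⟩ := e.exists_forall_far_disjoint hK₀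
  set Ra : ℝ := max R₀ Rs₁ with hRa
  have hRaR : e.R < Ra := lt_of_lt_of_le hRs₁ (le_max_right _ _)
  have hRs₁Ra : Rs₁ ≤ Ra := le_max_right _ _
  have hdisj : Disjoint (e.far Ra) K₀ := hR₀ Ra (le_max_left _ _)
  set Rb : ℝ := Ra + 1 with hRb
  have hRaRb : Ra < Rb := by rw [hRb]; linarith
  have hRbR : e.R < Rb := hRaR.trans hRaRb
  have hev1 : ∀ᶠ R in atTop, e.wDist (Gh R) (G 0) < 1 :=
    hw (gt_mem_nhds (show (0 : ℝ≥0∞) < 1 from zero_lt_one))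
  obtain ⟨R₁, hR₁⟩ := eventually_atTop.1 hev1
  set Rstar : ℝ := max Rb R₁ with hRstar
  have hRbRstar : Rb ≤ Rstar := le_max_left _ _
  have hR₁Rstar : R₁ ≤ Rstar := le_max_right _ _
  have hRaRstar : Ra < Rstar := hRaRb.trans_le hRbRstar
  have hRstarR : e.R < Rstar := hRbR.trans_le hRbRstar
  have hRs₁Rstar : Rs₁ < Rstar := hRs₁Ra.trans_lt hRaRstar
  -- the effective radius `max R Rstar`
  have hmaxRs₁ : ∀ R : ℝ, Rs₁ < max R Rstar := fun R ↦ hRs₁Rstar.trans_le (le_max_right _ _)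
  have hmaxRb : ∀ R : ℝ, Rb ≤ max R Rstar := fun R ↦ hRbRstar.trans (le_max_right _ _)
  have hmax_of_lt : ∀ {R : ℝ}, Rstar < R → max R Rstar = R := fun hR ↦ max_eq_left hR.le
  -- the patch sets
  set W : Set X := e.far Ra with hW
  set C : Set X := e.closedFar Rb with hC
  have hWo : IsOpen W := e.isOpen_far Ra
  have hCc : IsClosed C := e.isClosed_closedFar hRbR
  have hCW : C ⊆ W := e.closedFar_subset_far hRaRb
  have hWK : ∀ x ∈ W, x ∉ K₀ := fun x hx hxK ↦ Set.disjoint_left.1 hdisj hx hxK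
  have hGcW : ∀ (c : EuclideanSpace ℝ (Fin 1)), ∀ x ∈ W,
      (G c).h.inner x = (G 0).h.inner x ∧ (G c).k x = (G 0).k x := fun c x hx ↦ hK₀G c x (hWK x hx)
  have hGh_off : ∀ R' : ℝ, Rs₁ < R' → ∀ x ∉ e.far R',
      (Gh R').h.inner x = (G 0).h.inner x ∧ (Gh R').k x = (G 0).k x :=
    fun R' hR' x hx ↦ (hmem R' hR').2.1 x hx
  have hGhC : ∀ R' : ℝ, Rb ≤ R' → ∀ x ∉ C,
      (Gh R').h.inner x = (G 0).h.inner x ∧ (Gh R').k x = (G 0).k x := by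
    intro R' hR' x hxC
    have hxfar : x ∉ e.far R' := fun hx ↦ hxC (e.far_subset_closedFar Rb (e.far_mono hR' hx))
    exact hGh_off R' (hRs₁Ra.trans_lt (hRaRb.trans_le hR')) x hxfar
  -- patch data for every parameter `c` and every effective radius `R' ≥ Rb`
  have P : ∀ (c : EuclideanSpace ℝ (Fin 1)) (R' : ℝ), Rb ≤ R' →
      (G c).PatchData W C (Gh R').h.inner (Gh R').k := fun c R' hR' ↦
    { isOpen := hWo
      isClosed := hCc
      subset := hCW
      smooth_h := (Gh R').h.contMDiff.contMDiffOn
      smooth_k := (Gh R').contMDiff_k.contMDiffOn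
      symm_h := fun x _ v w ↦ (Gh R').h.symm x v w
      pos_h := fun x _ v hv ↦ (Gh R').h.pos x v hv
      symm_k := fun x _ v w ↦ (Gh R').k_symm x v w
      agree_h := fun x hxW hxC ↦ ((hGhC R' hR' x hxC).1).trans ((hGcW c x hxW).1).symm
      agree_k := fun x hxW hxC ↦ ((hGhC R' hR' x hxC).2).trans ((hGcW c x hxW).2).symm }
  -- the glued family (made opaque) and its section formulas
  obtain ⟨H, hH⟩ : ∃ H : EuclideanSpace ℝ (Fin 1) → ℝ → InitialDataSet (𝓡 3) X,
      ∀ c R, H c R = (G c).patch (P c (max R Rstar) (hmaxRb R)) := ⟨_, fun _ _ ↦ rfl⟩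
  have hH_W : ∀ (c : EuclideanSpace ℝ (Fin 1)) (R : ℝ), ∀ x ∈ W,
      (H c R).h.inner x = (Gh (max R Rstar)).h.inner x ∧ (H c R).k x = (Gh (max R Rstar)).k x := by
    intro c R x hx
    rw [hH c R]
    exact ⟨InitialDataSet.patch_h_inner_of_mem _ hx, InitialDataSet.patch_k_of_mem _ hx⟩
  have hH_nW : ∀ (c : EuclideanSpace ℝ (Fin 1)) (R : ℝ), ∀ x ∉ W,
      (H c R).h.inner x = (G c).h.inner x ∧ (H c R).k x = (G c).k x := by
    intro c R x hx
    rw [hH c R]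
    exact ⟨InitialDataSet.patch_h_inner_of_not_mem _ hx, InitialDataSet.patch_k_of_not_mem _ hx⟩
  have hH_nC : ∀ (c : EuclideanSpace ℝ (Fin 1)) (R : ℝ), ∀ x ∉ C,
      (H c R).h.inner x = (G c).h.inner x ∧ (H c R).k x = (G c).k x := by
    intro c R x hx
    rw [hH c R]
    exact ⟨InitialDataSet.patch_h_inner_of_not_mem_closed _ hx, InitialDataSet.patch_k_of_not_mem_closed _ hx⟩
  -- members agree with `G c` off `e.far R` (for `R > Rstar`)
  have hagree : ∀ (c : EuclideanSpace ℝ (Fin 1)) (R : ℝ), Rstar < R → ∀ x ∉ e.far R, AgreeAt (H c R) (G c) x := by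
    intro c R hR x hx
    by_cases hxW : x ∈ W
    · obtain ⟨h1, h2⟩ := hH_W c R x hxW
      rw [hmax_of_lt hR] at h1 h2
      obtain ⟨h3, h4⟩ := hGh_off R (hRs₁Rstar.trans hR) x hx
      obtain ⟨h5, h6⟩ := hGcW c x hxW
      exact ⟨h1.trans (h3.trans h5.symm), h2.trans (h4.trans h6.symm)⟩
    · exact hH_nW c R x hxW
  -- decay: the far field of `H c R` is that of `Gh (max R Rstar)`
  have hDRH : ∀ (c : EuclideanSpace ℝ (Fin 1)) (R : ℝ),
      e.IsStronglyAsymptoticallyFlatDR (H c R) (m₁ (max R Rstar)) := fun c R ↦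
    (hmem _ (hmaxRs₁ R)).2.2.1.congr_of_eqOn_far (R₀ := Ra) (fun q hq ↦ (hH_W c R q hq).1)
      (fun q hq ↦ (hH_W c R q hq).2)
  -- the weighted distance to the base member is that of the re-ending to the base, EXACTLY
  have hwDist : ∀ (c : EuclideanSpace ℝ (Fin 1)) (R : ℝ),
      e.wDist (H c R) (G c) = e.wDist (Gh (max R Rstar)) (G 0) := by
    intro c R
    refine wDist_eq_of_coeff_sub_eq e (fun y hy ↦ ?_) (fun y hy ↦ ?_)
    · refine hCoeff_sub_eq_of_inner_sub_eq e hy fun v w ↦ ?_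
      by_cases hq : e.dataChartExt y ∈ W
      · rw [(hH_W c R _ hq).1, (hGcW c _ hq).1]
      · have hq' : e.dataChartExt y ∉ e.far (max R Rstar) := fun h ↦ hq (e.far_mono hRaRstar.le
          (e.far_mono (le_max_right R Rstar) h))
        rw [(hH_nW c R _ hq).1, (hGh_off _ (hmaxRs₁ R) _ hq').1, sub_self, sub_self]
    · refine kCoeff_sub_eq_of_k_sub_eq e hy fun v w ↦ ?_
      by_cases hq : e.dataChartExt y ∈ W
      · rw [(hH_W c R _ hq).2, (hGcW c _ hq).2]
      · have hq' : e.dataChartExt y ∉ e.far (max R Rstar) := fun h ↦ hq (e.far_mono hRaRstar.le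
          (e.far_mono (le_max_right R Rstar) h))
        rw [(hH_nW c R _ hq).2, (hGh_off _ (hmaxRs₁ R) _ hq').2, sub_self, sub_self]
  -- members are admissible and Kerr-ended
  have hcpt : IsCompact (e.far Ra)ᶜ := hsole.isCompact_compl_far Ra
  have hmemH : ∀ (c : EuclideanSpace ℝ (Fin 1)) (R : ℝ),
      H c R ∈ admissibleVacuumData X ∧ (H c R).HasExactKerrEnd := by
    intro c R
    obtain ⟨hGhadm, -, -, hGhKE⟩ := hmem _ (hmaxRs₁ R)
    have hoff : ∀ x ∉ (e.far Ra)ᶜ, (H c R).h.inner x = (Gh (max R Rstar)).h.inner x ∧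
        (H c R).k x = (Gh (max R Rstar)).k x := fun x hx ↦ hH_W c R x (not_notMem.1 hx)
    refine ⟨InitialDataSet.mem_admissibleVacuumData_of_agree_off_compact hGhadm ?_ hcpt hoff,
      hGhKE.of_eq_off_compact hcpt (fun x hx ↦ (hoff x hx).1) fun x hx ↦ (hoff x hx).2⟩
    intro inst
    have hvacG : ∀ [(G c).metric.HasLeviCivita], (G c).IsVacuumConstraintSolution := fun {i} ↦ (hGadm c).1.1
    have hvacGh : ∀ [(Gh (max R Rstar)).metric.HasLeviCivita], (Gh (max R Rstar)).IsVacuumConstraintSolution :=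
      fun {i} ↦ hGhadm.1.1
    have key : ∀ (D : InitialDataSet (𝓡 3) X) [D.metric.HasLeviCivita],
        D = (G c).patch (P c (max R Rstar) (hmaxRb R)) → D.IsVacuumConstraintSolution := by
      rintro D _ rfl
      exact isVacuumConstraintSolution_patch_of_vacuum _ hvacG hvacGh
    exact key (H c R) (hH c R)
  -- joint smoothness of the sections of `(c, R) ↦ H c R` on the parameter domain (locality)
  have hsmooth : SmoothSectionsOn (𝓘(ℝ, EuclideanSpace ℝ (Fin 1)).prod 𝓘(ℝ, ℝ))
      (fun q : EuclideanSpace ℝ (Fin 1) × ℝ ↦ H q.1 q.2) (gluedDom X 1 Rstar) :=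
    ⟨contMDiffOn_twoParam_sections (a := fun R x ↦ (Gh R).h.inner x) (b := fun c x ↦ (G c).h.inner x)
        (s := fun c R x ↦ (H c R).h.inner x) hWo hCc hCW hRs₁Rstar hGh.1 hGsm.1
        (fun c R x hx ↦ (hH_W c R x hx).1) (fun c R x hx ↦ (hH_nC c R x hx).1),
      contMDiffOn_twoParam_sections (a := fun R x ↦ (Gh R).k x) (b := fun c x ↦ (G c).k x)
        (s := fun c R x ↦ (H c R).k x) hWo hCc hCW hRs₁Rstar hGh.2 hGsm.2
        (fun c R x hx ↦ (hH_W c R x hx).2) (fun c R x hx ↦ (hH_nC c R x hx).2)⟩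
  -- continuity of the masses on the parameter domain
  have hmcont : ContinuousOn (fun q : EuclideanSpace ℝ (Fin 1) × ℝ ↦ m₁ (max q.2 Rstar))
      {q | ‖q.1‖ < 1 ∧ Rstar < q.2} :=
    (hm₁.comp (continuous_snd.max continuous_const).continuousOn fun q _ ↦ hmaxRs₁ q.2)
  -- assemble
  refine ⟨1, Rstar, fun _ R ↦ m₁ (max R Rstar), H, one_pos, hRstarR, ⟨hmcont, hsmooth, fun c R _ hR ↦
    ⟨hagree c R hR, hDRH c R⟩⟩, fun c R _ _ ↦ hmemH c R, ?_, ?_, ?_, ?_⟩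
  · -- the far field on `e.far Rstar ⊆ W` does not depend on `c`
    intro c c' R x hx
    have hxW : x ∈ W := e.far_mono hRaRstar.le hx
    exact ⟨((hH_W c R x hxW).1).trans ((hH_W c' R x hxW).1).symm,
      ((hH_W c R x hxW).2).trans ((hH_W c' R x hxW).2).symm⟩
  · -- pointwise weighted convergence
    intro c _
    have hev : (fun R ↦ e.wDist (Gh R) (G 0)) =ᶠ[atTop] fun R ↦ e.wDist (H c R) (G c) := by
      filter_upwards [eventually_gt_atTop Rstar] with R hR
      rw [hwDist c R, hmax_of_lt hR]
    exact hw.congr' hev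
  · -- joint convergence
    intro η hη
    obtain ⟨Rw, hRw⟩ := eventually_atTop.1 (hw (gt_mem_nhds (ENNReal.ofReal_pos.2 hη)))
    obtain ⟨Rm, hRm⟩ := eventually_atTop.1 (hm₁M (Metric.ball_mem_nhds (Mf 0) (half_pos hη)))
    obtain ⟨δ, hδ, hδM⟩ := Metric.continuousAt_iff.1 hMf.continuousAt (η / 2) (half_pos hη)
    refine ⟨min δ 1, max Rstar (max Rw Rm), lt_min hδ one_pos, min_le_right _ _, le_max_left _ _,
      fun c R hc hR ↦ ?_⟩
    have hRstarR' : Rstar < R := lt_of_le_of_lt (le_max_left _ _) hR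
    have hRwR : Rw ≤ R := ((le_max_left _ _).trans (le_max_right _ _)).trans hR.le
    have hRmR : Rm ≤ R := ((le_max_right _ _).trans (le_max_right _ _)).trans hR.le
    beta_reduce
    rw [hwDist c R, hmax_of_lt hRstarR']
    refine ⟨hRw R hRwR, ?_⟩
    have h1 : dist (m₁ R) (Mf 0) < η / 2 := hRm R hRmR
    have h2 : dist (Mf c) (Mf 0) < η / 2 := hδM (by simpa using lt_of_lt_of_le hc (min_le_left _ _))
    rw [Real.dist_eq] at h1 h2
    calc |m₁ R - Mf c| = |(m₁ R - Mf 0) - (Mf c - Mf 0)| := by ring_nf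
      _ ≤ |m₁ R - Mf 0| + |Mf c - Mf 0| := abs_sub _ _
      _ < η / 2 + η / 2 := add_lt_add h1 h2
      _ = η := by ring
  · -- uniform bound `B = 1`
    refine ⟨1, fun c R _ hR ↦ ?_⟩
    rw [hwDist c R, hmax_of_lt hR, ENNReal.ofReal_one]
    exact (hR₁ R (hR₁Rstar.trans hR.le)).le

end Summit.FinalStateConjecture.FinalStateConjecture.Theorems.ExactKerrEnds.CensorshipAlongKerrEnds

end
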